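import Summits.RiemannHypothesis.RiemannHypothesis.Theorems.UniversalFactorNarrowKernelNoGoEnergyLowerFubini
import Summits.RiemannHypothesis.RiemannHypothesis.Theorems.UniversalFactorNarrowKernelNoGoEnergyLowerInner

/-!
# RiemannHypothesis / UniversalFactor — `NarrowKernelNoGo`, line `Sketch`, stub K1a (energy lower
bound): the smoothed block integral against the kernel — pointwise and integrated error bounds

Route `RiemannHypothesis/UniversalFactor`, crux `NarrowKernelNoGo` (stmt-RiemannHypothesis-2576), stub
`UniversalFactor.stub_narrowEnergyLowerClean` (lead). With `Inner(u) = ∫_B Z(t+u) conj(E₁ t) D(t) dt`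
(`D = Σ c_n n^{it}`), `Mn(u) = Σ c_n n^{-1/2} e^{−iu log n}`, `L = ½ log(T'/2π)`:

* `UniversalFactor.narrowBlock_pointwise` — for EVERY shift `u`,
  `‖κ(u)(Inner(u) − e^{iuL} U Mn(u))‖ ≤ κ(u)(A₀ + (U|u| + u²) A₁/T') + 𝟙_{|u|>u₀} (1+|u|) κ(u) A₂` with the
  block constants `A₀` (Montgomery–Vaughan + van der Corput + AFE error), `A₁` (phase defect), `A₂`
  (crude);
* `UniversalFactor.narrowBlock_integrated` — integrating in `u`:
  `‖∫_B g conj(E₁) D − U Σ c_n n^{-1/2} q_n‖ ≤ K₀ A₀ + (U K₁ + K₂) A₁/T' + A₂ ∫_{|u|>u₀} (1+|u|)κ`.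

References: Titchmarsh (1986) §7.3–7.4.
-/

noncomputable section

-- D-0017: `Summit.<S>.<S>.…` is the designed namespace of a single-problem summit.
set_option linter.dupNamespace false

namespace Summit.RiemannHypothesis.RiemannHypothesis.Theorems

open MeasureTheory Set Filter Complex intervalIntegral
open scoped Real Topology ComplexConjugate
open Literature.NumberTheory.LFunctions Literature.NumberTheory.LFunctions.TwistedMoment

/-! ## Auxiliary bounds for the shifted mean squares -/

/-- `∫_B ‖S_P(t+u)‖² dt ≤ U(1 + log P) + 1856 P`. [cite: Titchmarsh1986, §7.3] -/
theorem UniversalFactor.narrow_integral_norm_sq_mainSum_shift_le (P : ℕ) {T' U : ℝ} (hU : 0 ≤ U) (u : ℝ) :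
    ∫ t in T'..(T' + U), ‖mainSum P (t + u)‖ ^ 2 ≤ U * (1 + Real.log P) + 1856 * P := by
  have h := integral_norm_sq_mainSum_le P (a := T' + u) (b := T' + U + u) (by linarith)
  rw [show T' + U + u - (T' + u) = U by ring] at h
  have hshift : ∫ t in T'..(T' + U), ‖mainSum P (t + u)‖ ^ 2 = ∫ t in (T' + u)..(T' + U + u), ‖mainSum P t‖ ^ 2 := by
    rw [← intervalIntegral.integral_comp_add_right (fun t => ‖mainSum P t‖ ^ 2) u]
  rw [hshift]
  exact h

/-- `∫_B ‖e_P(t+u)‖² dt ≤ ∫_{T'−u₀}^{T'+U+u₀} ‖e_P‖²` for `|u| ≤ u₀ < T'`. [folklore] -/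
theorem UniversalFactor.narrow_integral_norm_sq_hardyZErr_shift_le (P : ℕ) {T' U u u₀ : ℝ} (hU : 0 ≤ U)
    (hu : |u| ≤ u₀) (hu₀ : u₀ < T') :
    ∫ t in T'..(T' + U), ‖hardyZErr P (t + u)‖ ^ 2 ≤ ∫ t in (T' - u₀)..(T' + U + u₀), ‖hardyZErr P t‖ ^ 2 := by
  have habs := abs_le.1 hu
  have hshift : ∫ t in T'..(T' + U), ‖hardyZErr P (t + u)‖ ^ 2 =
      ∫ t in (T' + u)..(T' + U + u), ‖hardyZErr P t‖ ^ 2 := by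
    rw [← intervalIntegral.integral_comp_add_right (fun t => ‖hardyZErr P t‖ ^ 2) u]
  rw [hshift]
  have hcont : ContinuousOn (fun t => ‖hardyZErr P t‖ ^ 2) (Icc (T' - u₀) (T' + U + u₀)) :=
    (continuousOn_norm_sq_hardyZErr P).mono fun t ht => by
      show (0:ℝ) < t
      linarith [ht.1]
  refine intervalIntegral.integral_mono_interval (by linarith) (by linarith) (by linarith)
    (Eventually.of_forall fun t => sq_nonneg _) ?_
  exact (hcont.mono (by rw [uIcc_of_le (by linarith)])).intervalIntegrable

/-- `‖Mn(u)‖ = ‖Σ c_n n^{-1/2} e^{−iu log n}‖ ≤ Σ ‖c_n‖`. [folklore] -/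
theorem UniversalFactor.norm_narrowMn_le (P : ℕ) (c : ℕ → ℂ) (u : ℝ) :
    ‖∑ n ∈ Finset.Icc 1 P, c n * ((((n : ℝ) ^ (-(1 / 2 : ℝ)) : ℝ) : ℂ) * cexp (-(I * u * Real.log n)))‖ ≤
      ∑ n ∈ Finset.Icc 1 P, ‖c n‖ := by
  refine (norm_sum_le _ _).trans (Finset.sum_le_sum fun n hn => ?_)
  have hn1 : 1 ≤ n := (Finset.mem_Icc.1 hn).1
  have hn0 : (0 : ℝ) < n := by exact_mod_cast hn1
  rw [norm_mul, norm_mul, Complex.norm_real, Real.norm_eq_abs, abs_of_nonneg (Real.rpow_nonneg hn0.le _),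
    show -(I * (u : ℂ) * (Real.log n : ℂ)) = ((-(u * Real.log n) : ℝ) : ℂ) * I by push_cast; ring,
    Complex.norm_exp_ofReal_mul_I, mul_one]
  have hle : (n : ℝ) ^ (-(1 / 2 : ℝ)) ≤ 1 := Real.rpow_le_one_of_one_le_of_nonpos (by exact_mod_cast hn1) (by norm_num)
  exact mul_le_of_le_one_right (norm_nonneg _) hle

/-! ## The pointwise bound in the shift -/

/-- **Pointwise bound for every shift.** Let `a > π/8`, `0 < T'`, `0 ≤ U`, `0 ≤ u₀`, `u₀ ≤ T'/2`,
`2πP² ≤ T' − u₀`, `η > 0`, and `c_n = 0` unless `8πn² ≤ T'`. Then for every real `u`,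
`‖κ(u)(Inner(u) − e^{iuL} U Mn(u))‖ ≤ κ(u)(A₀ + (U|u| + u²) A₁/T') + 𝟙_{u₀ < |u|}(u)·(1+|u|)κ(u)·A₂`, where
`A₀ = 3712(P + Σ n‖c_n‖²) + (2/log 2)(Σ_{μ≤P} μ^{-1/2})(Σ‖c_n‖) + (η I_e + I_D/η)/2`,
`A₁ = (I_D + U(1+log P) + 1856P)/2`, `A₂ = U(3 + 2(T'+U)) Σ‖c_n‖`, `I_D = ∫_B ‖D‖²`,
`I_e = ∫_{T'−u₀}^{T'+U+u₀} ‖e_P‖²`. [folklore] -/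
theorem UniversalFactor.narrowBlock_pointwise {a : ℝ} (P : ℕ) (c : ℕ → ℂ) {T' U u₀ η : ℝ} (hT' : 0 < T')
    (hU : 0 ≤ U) (hu₀ : 0 ≤ u₀) (hu₀T : u₀ ≤ T' / 2) (hη : 0 < η) (hP : 2 * π * (P : ℝ) ^ 2 ≤ T' - u₀)
    (hc : ∀ ν ∈ Finset.Icc 1 P, c ν ≠ 0 → 8 * π * (ν : ℝ) ^ 2 ≤ T') (u : ℝ) :
    ‖((Real.exp (-(2 * a * |u|)) * Real.exp (-(π * u / 4)) : ℝ) : ℂ) *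
        ((∫ t in T'..(T' + U), (hardyZ (t + u) : ℂ) *
          (conj (thetaMainPhase t) * ∑ n ∈ Finset.Icc 1 P, c n * (n : ℂ) ^ ((t : ℂ) * I))) -
        cexp (I * u * ((Real.log (T' / (2 * π)) / 2 : ℝ) : ℂ)) * (U * ∑ n ∈ Finset.Icc 1 P,
          c n * ((((n : ℝ) ^ (-(1 / 2 : ℝ)) : ℝ) : ℂ) * cexp (-(I * u * Real.log n)))))‖ ≤
      Real.exp (-(2 * a * |u|)) * Real.exp (-(π * u / 4)) *
        ((3712 * ((P : ℝ) + ∑ n ∈ Finset.Icc 1 P, (n : ℝ) * ‖c n‖ ^ 2) +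
          2 / Real.log 2 * (∑ μ ∈ Finset.Icc 1 P, (μ : ℝ) ^ (-(1 / 2 : ℝ))) * (∑ ν ∈ Finset.Icc 1 P, ‖c ν‖) +
          (η * (∫ t in (T' - u₀)..(T' + U + u₀), ‖hardyZErr P t‖ ^ 2) +
            (∫ t in T'..(T' + U), ‖∑ n ∈ Finset.Icc 1 P, c n * (n : ℂ) ^ ((t : ℂ) * I)‖ ^ 2) / η) / 2) +
        (U * |u| + u ^ 2) / T' *
          (((∫ t in T'..(T' + U), ‖∑ n ∈ Finset.Icc 1 P, c n * (n : ℂ) ^ ((t : ℂ) * I)‖ ^ 2) +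
            (U * (1 + Real.log P) + 1856 * P)) / 2)) +
      {v : ℝ | u₀ < |v|}.indicator (fun v => (1 + |v|) * (Real.exp (-(2 * a * |v|)) * Real.exp (-(π * v / 4)))) u *
        (U * (3 + 2 * (T' + U)) * ∑ n ∈ Finset.Icc 1 P, ‖c n‖) := by
  have hκpos := UniversalFactor.narrowKer_pos a u
  set κu : ℝ := Real.exp (-(2 * a * |u|)) * Real.exp (-(π * u / 4)) with hκu
  set ID : ℝ := ∫ t in T'..(T' + U), ‖∑ n ∈ Finset.Icc 1 P, c n * (n : ℂ) ^ ((t : ℂ) * I)‖ ^ 2 with hID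
  set Ie : ℝ := ∫ t in (T' - u₀)..(T' + U + u₀), ‖hardyZErr P t‖ ^ 2 with hIe
  set SC : ℝ := ∑ n ∈ Finset.Icc 1 P, ‖c n‖ with hSC
  have hID0 : 0 ≤ ID := intervalIntegral.integral_nonneg (by linarith) fun t _ => sq_nonneg _
  have hIe0 : 0 ≤ Ie := intervalIntegral.integral_nonneg (by linarith) fun t _ => sq_nonneg _
  have hSC0 : 0 ≤ SC := Finset.sum_nonneg fun n _ => norm_nonneg _
  have hsumμ : 0 ≤ ∑ μ ∈ Finset.Icc 1 P, (μ : ℝ) ^ (-(1 / 2 : ℝ)) :=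
    Finset.sum_nonneg fun μ _ => Real.rpow_nonneg (Nat.cast_nonneg μ) _
  have hsumc : 0 ≤ ∑ n ∈ Finset.Icc 1 P, (n : ℝ) * ‖c n‖ ^ 2 := Finset.sum_nonneg fun n _ => by positivity
  have hlog2 : 0 < Real.log 2 := Real.log_pos (by norm_num)
  -- the main bracket is nonnegative
  set A₀ : ℝ := 3712 * ((P : ℝ) + ∑ n ∈ Finset.Icc 1 P, (n : ℝ) * ‖c n‖ ^ 2) +
      2 / Real.log 2 * (∑ μ ∈ Finset.Icc 1 P, (μ : ℝ) ^ (-(1 / 2 : ℝ))) * SC + (η * Ie + ID / η) / 2 with hA₀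
  set A₁ : ℝ := (ID + (U * (1 + Real.log P) + 1856 * P)) / 2 with hA₁
  set A₂ : ℝ := U * (3 + 2 * (T' + U)) * SC with hA₂
  have hA₀0 : 0 ≤ A₀ := by positivity
  have hlogP : 0 ≤ 1 + Real.log P := by
    rcases Nat.eq_zero_or_pos P with hP0 | hP0
    · simp [hP0]
    · have : (1 : ℝ) ≤ P := by exact_mod_cast hP0
      linarith [Real.log_nonneg this]
  have hA₁0 : 0 ≤ A₁ := by positivity
  have hA₂0 : 0 ≤ A₂ := by positivity
  rw [norm_mul, Complex.norm_real, Real.norm_eq_abs, abs_of_pos hκpos]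
  rcases le_or_gt |u| u₀ with hsmall | hlarge
  · -- `|u| ≤ u₀`: the main estimate
    have hmain := UniversalFactor.narrowInner_main_le P c hT' hU hu₀T hsmall hη hP hc
    have hS := UniversalFactor.narrow_integral_norm_sq_mainSum_shift_le P (T' := T') hU u
    have he := UniversalFactor.narrow_integral_norm_sq_hardyZErr_shift_le P hU hsmall (by linarith : u₀ < T')
    have hind : {v : ℝ | u₀ < |v|}.indicator
        (fun v => (1 + |v|) * (Real.exp (-(2 * a * |v|)) * Real.exp (-(π * v / 4)))) u = 0 := by
      rw [Set.indicator_of_notMem]; simpa using hsmall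
    rw [hind, zero_mul, add_zero]
    refine mul_le_mul_of_nonneg_left ?_ hκpos.le
    -- compare term by term
    have h1 : |u| * (U + |u|) / T' * ((ID + ∫ t in T'..(T' + U), ‖mainSum P (t + u)‖ ^ 2) / 2) ≤
        (U * |u| + u ^ 2) / T' * A₁ := by
      have hfac : |u| * (U + |u|) / T' = (U * |u| + u ^ 2) / T' := by rw [← sq_abs]; ring
      rw [hfac]
      refine mul_le_mul_of_nonneg_left ?_ (by positivity)
      simp only [hA₁]
      linarith
    have h2 : (η * (∫ t in T'..(T' + U), ‖hardyZErr P (t + u)‖ ^ 2) + ID / η) / 2 ≤ (η * Ie + ID / η) / 2 := by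
      have := mul_le_mul_of_nonneg_left he hη.le
      linarith
    simp only [hA₀, hA₁] at *
    linarith [hmain, h1, h2]
  · -- `|u| > u₀`: crude bound
    have hind : {v : ℝ | u₀ < |v|}.indicator
        (fun v => (1 + |v|) * (Real.exp (-(2 * a * |v|)) * Real.exp (-(π * v / 4)))) u = (1 + |u|) * κu := by
      rw [Set.indicator_of_mem]; exact hlarge
    rw [hind]
    have hcrude := UniversalFactor.narrowInner_crude_le P c hT'.le hU u
    have hMn := UniversalFactor.norm_narrowMn_le P c u
    have hph : ‖cexp (I * u * ((Real.log (T' / (2 * π)) / 2 : ℝ) : ℂ))‖ = 1 := by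
      rw [show I * (u : ℂ) * (((Real.log (T' / (2 * π)) / 2 : ℝ)) : ℂ) =
        ((u * (Real.log (T' / (2 * π)) / 2) : ℝ) : ℂ) * I by push_cast; ring, Complex.norm_exp_ofReal_mul_I]
    have hsub : ‖(∫ t in T'..(T' + U), (hardyZ (t + u) : ℂ) *
          (conj (thetaMainPhase t) * ∑ n ∈ Finset.Icc 1 P, c n * (n : ℂ) ^ ((t : ℂ) * I))) -
        cexp (I * u * ((Real.log (T' / (2 * π)) / 2 : ℝ) : ℂ)) * (U * ∑ n ∈ Finset.Icc 1 P,
          c n * ((((n : ℝ) ^ (-(1 / 2 : ℝ)) : ℝ) : ℂ) * cexp (-(I * u * Real.log n))))‖ ≤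
        U * (2 + 2 * (T' + U) + 2 * |u|) * SC + U * SC := by
      refine (norm_sub_le _ _).trans (add_le_add hcrude ?_)
      rw [norm_mul, hph, one_mul, norm_mul, Complex.norm_real, Real.norm_eq_abs, abs_of_nonneg hU]
      exact mul_le_mul_of_nonneg_left hMn hU
    have hfinal : U * (2 + 2 * (T' + U) + 2 * |u|) * SC + U * SC ≤ (1 + |u|) * A₂ := by
      simp only [hA₂]
      have h0 : 0 ≤ |u| := abs_nonneg u
      nlinarith [mul_nonneg (mul_nonneg hU hSC0) h0, mul_nonneg (mul_nonneg (mul_nonneg hU hSC0) h0) hT'.le,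
        mul_nonneg (mul_nonneg (mul_nonneg hU hSC0) h0) hU]
    have hextra : 0 ≤ κu * (A₀ + (U * |u| + u ^ 2) / T' * A₁) := by positivity
    calc κu * ‖(∫ t in T'..(T' + U), (hardyZ (t + u) : ℂ) *
          (conj (thetaMainPhase t) * ∑ n ∈ Finset.Icc 1 P, c n * (n : ℂ) ^ ((t : ℂ) * I))) -
        cexp (I * u * ((Real.log (T' / (2 * π)) / 2 : ℝ) : ℂ)) * (U * ∑ n ∈ Finset.Icc 1 P,
          c n * ((((n : ℝ) ^ (-(1 / 2 : ℝ)) : ℝ) : ℂ) * cexp (-(I * u * Real.log n))))‖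
        ≤ κu * ((1 + |u|) * A₂) := mul_le_mul_of_nonneg_left (hsub.trans hfinal) hκpos.le
      _ = (1 + |u|) * κu * A₂ := by ring
      _ ≤ κu * (A₀ + (U * |u| + u ^ 2) / T' * A₁) + (1 + |u|) * κu * A₂ := by linarith

/-! ## Integration in the shift -/

/-- **Integrated bound.** Under the hypotheses of `narrowBlock_pointwise` (and `a > π/8`), with
`q_n = ∫ κ(u) e^{i(L − log n)u} du`, `L = ½ log(T'/2π)`:
`‖∫_B g conj(E₁) D − U Σ c_n n^{-1/2} q_n‖ ≤ K₀ A₀ + (U K₁ + K₂) A₁ / T' + A₂ ∫_{|u|>u₀} (1+|u|) κ`,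
`K₀ = ∫κ`, `K₁ = ∫|u|κ`, `K₂ = ∫u²κ`. [folklore] -/
theorem UniversalFactor.narrowBlock_integrated {a : ℝ} (ha : π / 8 < a) (P : ℕ) (c : ℕ → ℂ) {T' U u₀ η : ℝ}
    (hT' : 0 < T') (hU : 0 ≤ U) (hu₀ : 0 ≤ u₀) (hu₀T : u₀ ≤ T' / 2) (hη : 0 < η)
    (hP : 2 * π * (P : ℝ) ^ 2 ≤ T' - u₀) (hc : ∀ ν ∈ Finset.Icc 1 P, c ν ≠ 0 → 8 * π * (ν : ℝ) ^ 2 ≤ T') :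
    ‖(∫ t in T'..(T' + U),
        ((∫ u : ℝ, Real.exp (-(2 * a * |u|)) * Real.exp (-(π * u / 4)) * hardyZ (t + u) : ℝ) : ℂ) *
          (conj (thetaMainPhase t) * ∑ n ∈ Finset.Icc 1 P, c n * (n : ℂ) ^ ((t : ℂ) * I))) -
        U * ∑ n ∈ Finset.Icc 1 P, c n * (((n : ℝ) ^ (-(1 / 2 : ℝ)) : ℝ) : ℂ) *
          ∫ u : ℝ, ((Real.exp (-(2 * a * |u|)) * Real.exp (-(π * u / 4)) : ℝ) : ℂ) *
            cexp (I * ((Real.log (T' / (2 * π)) / 2 : ℝ) - Real.log n) * u)‖ ≤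
      (∫ u : ℝ, Real.exp (-(2 * a * |u|)) * Real.exp (-(π * u / 4))) *
        (3712 * ((P : ℝ) + ∑ n ∈ Finset.Icc 1 P, (n : ℝ) * ‖c n‖ ^ 2) +
          2 / Real.log 2 * (∑ μ ∈ Finset.Icc 1 P, (μ : ℝ) ^ (-(1 / 2 : ℝ))) * (∑ ν ∈ Finset.Icc 1 P, ‖c ν‖) +
          (η * (∫ t in (T' - u₀)..(T' + U + u₀), ‖hardyZErr P t‖ ^ 2) +
            (∫ t in T'..(T' + U), ‖∑ n ∈ Finset.Icc 1 P, c n * (n : ℂ) ^ ((t : ℂ) * I)‖ ^ 2) / η) / 2) +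
      (U * (∫ u : ℝ, |u| * (Real.exp (-(2 * a * |u|)) * Real.exp (-(π * u / 4)))) +
        ∫ u : ℝ, u ^ 2 * (Real.exp (-(2 * a * |u|)) * Real.exp (-(π * u / 4)))) / T' *
          (((∫ t in T'..(T' + U), ‖∑ n ∈ Finset.Icc 1 P, c n * (n : ℂ) ^ ((t : ℂ) * I)‖ ^ 2) +
            (U * (1 + Real.log P) + 1856 * P)) / 2) +
      (∫ u in {v : ℝ | u₀ < |v|}, (1 + |u|) ^ 1 * (Real.exp (-(2 * a * |u|)) * Real.exp (-(π * u / 4)))) *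
        (U * (3 + 2 * (T' + U)) * ∑ n ∈ Finset.Icc 1 P, ‖c n‖) := by
  set L : ℝ := Real.log (T' / (2 * π)) / 2 with hL
  obtain ⟨hfub, hint⟩ := UniversalFactor.narrowFubini ha P c hT' hU
  -- the main term as a `u`-integral
  have hmainI := UniversalFactor.narrowMain_identity ha P c L
  have hint2 : Integrable fun u : ℝ => ((Real.exp (-(2 * a * |u|)) * Real.exp (-(π * u / 4)) : ℝ) : ℂ) *
      (cexp (I * u * L) * ∑ n ∈ Finset.Icc 1 P,
        c n * ((((n : ℝ) ^ (-(1 / 2 : ℝ)) : ℝ) : ℂ) * cexp (-(I * u * Real.log n)))) := by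
    have hk : Integrable fun u : ℝ => ((Real.exp (-(2 * a * |u|)) * Real.exp (-(π * u / 4)) : ℝ) : ℂ) :=
      (UniversalFactor.narrow_integrable_ker ha).ofReal
    refine hk.mul_of_top_left (memLp_top_of_bound (by fun_prop) (∑ n ∈ Finset.Icc 1 P, ‖c n‖)
      (Eventually.of_forall fun u => ?_))
    rw [norm_mul, show I * (u : ℂ) * (L : ℂ) = ((u * L : ℝ) : ℂ) * I by push_cast; ring,
      Complex.norm_exp_ofReal_mul_I, one_mul]
    exact UniversalFactor.norm_narrowMn_le P c u
  -- rewrite the difference as one integral in `u`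
  have hdiff : (∫ t in T'..(T' + U),
        ((∫ u : ℝ, Real.exp (-(2 * a * |u|)) * Real.exp (-(π * u / 4)) * hardyZ (t + u) : ℝ) : ℂ) *
          (conj (thetaMainPhase t) * ∑ n ∈ Finset.Icc 1 P, c n * (n : ℂ) ^ ((t : ℂ) * I))) -
        U * ∑ n ∈ Finset.Icc 1 P, c n * (((n : ℝ) ^ (-(1 / 2 : ℝ)) : ℝ) : ℂ) *
          ∫ u : ℝ, ((Real.exp (-(2 * a * |u|)) * Real.exp (-(π * u / 4)) : ℝ) : ℂ) * cexp (I * (L - Real.log n) * u) =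
      ∫ u : ℝ, ((Real.exp (-(2 * a * |u|)) * Real.exp (-(π * u / 4)) : ℝ) : ℂ) *
        ((∫ t in T'..(T' + U), (hardyZ (t + u) : ℂ) *
          (conj (thetaMainPhase t) * ∑ n ∈ Finset.Icc 1 P, c n * (n : ℂ) ^ ((t : ℂ) * I))) -
        cexp (I * u * L) * (U * ∑ n ∈ Finset.Icc 1 P,
          c n * ((((n : ℝ) ^ (-(1 / 2 : ℝ)) : ℝ) : ℂ) * cexp (-(I * u * Real.log n))))) := by
    rw [hfub, ← hmainI]
    have hU' : (U : ℂ) * ∫ u : ℝ, ((Real.exp (-(2 * a * |u|)) * Real.exp (-(π * u / 4)) : ℝ) : ℂ) *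
        (cexp (I * u * L) * ∑ n ∈ Finset.Icc 1 P,
          c n * ((((n : ℝ) ^ (-(1 / 2 : ℝ)) : ℝ) : ℂ) * cexp (-(I * u * Real.log n)))) =
        ∫ u : ℝ, ((Real.exp (-(2 * a * |u|)) * Real.exp (-(π * u / 4)) : ℝ) : ℂ) *
          (cexp (I * u * L) * (U * ∑ n ∈ Finset.Icc 1 P,
            c n * ((((n : ℝ) ^ (-(1 / 2 : ℝ)) : ℝ) : ℂ) * cexp (-(I * u * Real.log n))))) := by
      rw [← MeasureTheory.integral_const_mul]
      refine integral_congr_ae (Eventually.of_forall fun u => ?_)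
      ring
    have hint3 : Integrable fun u : ℝ => ((Real.exp (-(2 * a * |u|)) * Real.exp (-(π * u / 4)) : ℝ) : ℂ) *
        (cexp (I * u * L) * (U * ∑ n ∈ Finset.Icc 1 P,
          c n * ((((n : ℝ) ^ (-(1 / 2 : ℝ)) : ℝ) : ℂ) * cexp (-(I * u * Real.log n))))) :=
      (hint2.const_mul (U : ℂ)).congr (Eventually.of_forall fun u => by simp only; ring)
    rw [hU', ← integral_sub hint hint3]
    refine integral_congr_ae (Eventually.of_forall fun u => ?_)
    simp only
    ring
  rw [hdiff]
  -- the pointwise bound is integrable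
  have hK0 := UniversalFactor.narrow_integrable_ker ha
  have hK1 : Integrable fun u : ℝ => |u| * (Real.exp (-(2 * a * |u|)) * Real.exp (-(π * u / 4))) := by
    refine (UniversalFactor.narrow_integrable_pow_mul_ker ha 1).mono' (by fun_prop)
      (Eventually.of_forall fun u => ?_)
    have hκ := UniversalFactor.narrowKer_pos a u
    rw [Real.norm_eq_abs, abs_of_nonneg (by positivity), pow_one]
    nlinarith [abs_nonneg u]
  have hK2 : Integrable fun u : ℝ => u ^ 2 * (Real.exp (-(2 * a * |u|)) * Real.exp (-(π * u / 4))) := by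
    refine (UniversalFactor.narrow_integrable_pow_mul_ker ha 2).mono' (by fun_prop)
      (Eventually.of_forall fun u => ?_)
    have hκ := UniversalFactor.narrowKer_pos a u
    rw [Real.norm_eq_abs, abs_of_nonneg (by positivity)]
    have : u ^ 2 ≤ (1 + |u|) ^ 2 := by rw [← sq_abs]; nlinarith [abs_nonneg u]
    exact mul_le_mul_of_nonneg_right this hκ.le
  have hKt : Integrable fun u : ℝ => {v : ℝ | u₀ < |v|}.indicator
      (fun v => (1 + |v|) * (Real.exp (-(2 * a * |v|)) * Real.exp (-(π * v / 4)))) u :=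
    ((UniversalFactor.narrow_integrable_pow_mul_ker ha 1).congr (Eventually.of_forall fun u => by
      simp only [pow_one])).indicator (measurableSet_lt measurable_const continuous_abs.measurable)
  -- abbreviations of the constants
  set A₀ : ℝ := 3712 * ((P : ℝ) + ∑ n ∈ Finset.Icc 1 P, (n : ℝ) * ‖c n‖ ^ 2) +
      2 / Real.log 2 * (∑ μ ∈ Finset.Icc 1 P, (μ : ℝ) ^ (-(1 / 2 : ℝ))) * (∑ ν ∈ Finset.Icc 1 P, ‖c ν‖) +
      (η * (∫ t in (T' - u₀)..(T' + U + u₀), ‖hardyZErr P t‖ ^ 2) +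
        (∫ t in T'..(T' + U), ‖∑ n ∈ Finset.Icc 1 P, c n * (n : ℂ) ^ ((t : ℂ) * I)‖ ^ 2) / η) / 2 with hA₀
  set A₁ : ℝ := ((∫ t in T'..(T' + U), ‖∑ n ∈ Finset.Icc 1 P, c n * (n : ℂ) ^ ((t : ℂ) * I)‖ ^ 2) +
      (U * (1 + Real.log P) + 1856 * P)) / 2 with hA₁
  set A₂ : ℝ := U * (3 + 2 * (T' + U)) * ∑ n ∈ Finset.Icc 1 P, ‖c n‖ with hA₂
  set bound : ℝ → ℝ := fun u => Real.exp (-(2 * a * |u|)) * Real.exp (-(π * u / 4)) *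
      (A₀ + (U * |u| + u ^ 2) / T' * A₁) +
    {v : ℝ | u₀ < |v|}.indicator (fun v => (1 + |v|) * (Real.exp (-(2 * a * |v|)) * Real.exp (-(π * v / 4)))) u * A₂
    with hbound
  have hbound_int : Integrable bound := by
    have h1 : Integrable fun u : ℝ => Real.exp (-(2 * a * |u|)) * Real.exp (-(π * u / 4)) *
        (A₀ + (U * |u| + u ^ 2) / T' * A₁) := by
      have := (hK0.mul_const A₀).add (((hK1.const_mul U).add hK2).mul_const (A₁ / T'))
      refine this.congr (Eventually.of_forall fun u => ?_)
      simp only [Pi.add_apply]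
      ring
    exact h1.add (hKt.mul_const A₂)
  have hpt : ∀ u : ℝ, ‖((Real.exp (-(2 * a * |u|)) * Real.exp (-(π * u / 4)) : ℝ) : ℂ) *
      ((∫ t in T'..(T' + U), (hardyZ (t + u) : ℂ) *
          (conj (thetaMainPhase t) * ∑ n ∈ Finset.Icc 1 P, c n * (n : ℂ) ^ ((t : ℂ) * I))) -
        cexp (I * u * L) * (U * ∑ n ∈ Finset.Icc 1 P,
          c n * ((((n : ℝ) ^ (-(1 / 2 : ℝ)) : ℝ) : ℂ) * cexp (-(I * u * Real.log n)))))‖ ≤ bound u := by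
    intro u
    have := UniversalFactor.narrowBlock_pointwise (a := a) P c hT' hU hu₀ hu₀T hη hP hc u
    simpa only [hbound, hA₀, hA₁, hA₂, hL] using this
  refine (norm_integral_le_of_norm_le hbound_int (Eventually.of_forall hpt)).trans (le_of_eq ?_)
  -- evaluate `∫ bound`
  simp only [hbound]
  have hJ1 : Integrable fun u : ℝ => Real.exp (-(2 * a * |u|)) * Real.exp (-(π * u / 4)) *
      (A₀ + (U * |u| + u ^ 2) / T' * A₁) := by
    have := (hK0.mul_const A₀).add (((hK1.const_mul U).add hK2).mul_const (A₁ / T'))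
    refine this.congr (Eventually.of_forall fun u => ?_)
    simp only [Pi.add_apply]; ring
  have hJ2 : Integrable fun u : ℝ => {v : ℝ | u₀ < |v|}.indicator
      (fun v => (1 + |v|) * (Real.exp (-(2 * a * |v|)) * Real.exp (-(π * v / 4)))) u * A₂ := hKt.mul_const A₂
  rw [MeasureTheory.integral_add hJ1 hJ2, MeasureTheory.integral_mul_const, MeasureTheory.integral_indicator
    (measurableSet_lt measurable_const continuous_abs.measurable)]
  have hsplit : ∫ u : ℝ, Real.exp (-(2 * a * |u|)) * Real.exp (-(π * u / 4)) * (A₀ + (U * |u| + u ^ 2) / T' * A₁) =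
      (∫ u : ℝ, Real.exp (-(2 * a * |u|)) * Real.exp (-(π * u / 4))) * A₀ +
      (U * (∫ u : ℝ, |u| * (Real.exp (-(2 * a * |u|)) * Real.exp (-(π * u / 4)))) +
        ∫ u : ℝ, u ^ 2 * (Real.exp (-(2 * a * |u|)) * Real.exp (-(π * u / 4)))) / T' * A₁ := by
    have heq : ∀ u : ℝ, Real.exp (-(2 * a * |u|)) * Real.exp (-(π * u / 4)) * (A₀ + (U * |u| + u ^ 2) / T' * A₁) =
        Real.exp (-(2 * a * |u|)) * Real.exp (-(π * u / 4)) * A₀ +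
        (U * (|u| * (Real.exp (-(2 * a * |u|)) * Real.exp (-(π * u / 4)))) +
          u ^ 2 * (Real.exp (-(2 * a * |u|)) * Real.exp (-(π * u / 4)))) * (A₁ / T') := fun u => by ring
    simp_rw [heq]
    have hI1 : Integrable fun u : ℝ => Real.exp (-(2 * a * |u|)) * Real.exp (-(π * u / 4)) * A₀ := hK0.mul_const A₀
    have hI3 : Integrable fun u : ℝ => U * (|u| * (Real.exp (-(2 * a * |u|)) * Real.exp (-(π * u / 4)))) :=
      hK1.const_mul U
    have hI4 : Integrable fun u : ℝ => U * (|u| * (Real.exp (-(2 * a * |u|)) * Real.exp (-(π * u / 4)))) +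
        u ^ 2 * (Real.exp (-(2 * a * |u|)) * Real.exp (-(π * u / 4))) := hI3.add hK2
    have hI2 : Integrable fun u : ℝ => (U * (|u| * (Real.exp (-(2 * a * |u|)) * Real.exp (-(π * u / 4)))) +
        u ^ 2 * (Real.exp (-(2 * a * |u|)) * Real.exp (-(π * u / 4)))) * (A₁ / T') := hI4.mul_const _
    rw [MeasureTheory.integral_add hI1 hI2, MeasureTheory.integral_mul_const, MeasureTheory.integral_mul_const,
      MeasureTheory.integral_add hI3 hK2, MeasureTheory.integral_const_mul]
    ring
  rw [hsplit]
  simp only [pow_one]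

/-- Registered sub-stub `narrowBound_norm_Mn` of crux `stmt-RiemannHypothesis-2576` (binder-free restatement of
`UniversalFactor.norm_narrowMn_le`, used by the gate to attach this helper file to the crux). [folklore] -/
theorem UniversalFactor.narrowBound_norm_Mn : ∀ (P : ℕ) (c : ℕ → ℂ) (u : ℝ), ‖∑ n ∈ Finset.Icc 1 P, c n * ((((n : ℝ) ^ (-(1 / 2 : ℝ)) : ℝ) : ℂ) * Complex.exp (-(Complex.I * u * Real.log n)))‖ ≤ ∑ n ∈ Finset.Icc 1 P, ‖c n‖ :=
  fun P c u => UniversalFactor.norm_narrowMn_le P c u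

end Summit.RiemannHypothesis.RiemannHypothesis.Theorems
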